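import Summits.BirchSwinnertonDyer.BirchSwinnertonDyer.Theorems.GenusKolyvaginAtTwoPowDvdShaCardAtTwoRTLadderFrame
import HarnessLib

/-!
# Route `GenusKolyvaginAtTwo`, LINE 18 (L_T `PowDvdShaCardAtTwoRT`, stmt-BirchSwinnertonDyer-23242), stub 3a‴ `stub_twinLadderGenus`
# — the frame theorem in AVOIDANCE form (McCallum Prop. 5.2's own shape)

Seat `bsd-line-gk2-p3` g18 (cell `bsd-f1-sign2`), `--supports stmt-BirchSwinnertonDyer-23242` (helper; closes nothing).
THEOREMS ONLY (no definition, no named fact, no `sorry`); BSD is not proved by any of this.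

`…RTLadderFrame.two_mul_le_padicValNat_add_of_shaLadders` consumes, for each rung, an INDEPENDENT FAMILY of `2m+2` classes.
McCallum's Proposition 5.2 produces such families one class at a time: *"there exists `n ∈ S_r(M)` such that `c_M(n)` has
order `p^{M−M_r}` and `⟨c_M(n)⟩ ∩ C = {0}`"* for a given `C` of rank `≤ r`.  This file restates the frame theorem with exactly
that shape of hypothesis (`exists_indepFamily_of_forall_exists_avoiding` of `…RTLadderCount` run inside the subgroup
`res⁻¹(Ш(X_K/K)) ≤ H¹(ℚ, X)`):

* `exists_shaFamily_of_forall_exists_avoiding` — in `H¹(ℚ, X)`: if every independent family of fewer than `s` classes of order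
  `2^a` restricting into `Ш(X_K/K)` is avoided by a class of order `2^a` restricting into `Ш(X_K/K)`, there is an independent
  family of `s` such classes;
* **`two_mul_le_padicValNat_add_of_shaAvoiding`** / **`twinLadderGenus_ineq_of_shaAvoiding_of_padicValNat_eq_one`** — the
  frame theorem / 3a‴ on `ord₂ C(Wd) = 1` from the AVOIDANCE statements at every rung: odd depth `2m+1` over `W` (avoid families
  of `< 2m+2` classes), even depth `2m+2` over `Wd` (likewise) — i.e. from McCallum Prop. 5.2 over `ℚ` at `2` read on the
  descended classes `d_{M_{r−1}}(n) ∈ H¹(ℚ, E^{(±)})`.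

References: [McCallumLMS1991] §5 Prop. 5.2, Thm. 5.4; [GrossLMS1991] Prop. 5.4.
-/

set_option autoImplicit false
-- the Theorems namespace of this sub repeats the summit name by design (D-0017 nested layout)
set_option linter.dupNamespace false

noncomputable section

open scoped Classical

namespace Summit.BirchSwinnertonDyer.BirchSwinnertonDyer.Theorems.GenusExact.PlusDescent

open WeierstrassCurve NumberField IsDedekindDomain Rat.HeightOneSpectrum Literature.NumberTheory.EllipticCurves
  Literature.Barriers.BirchSwinnertonDyer

/-! ## §1 Greedy inside a subgroup of `H¹(ℚ, X)` -/

section Greedy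

variable {G : Type*} [AddCommGroup G] (R : AddSubgroup G)

/-- **Avoidance builds independent families inside a subgroup** (the min–max lemma `exists_indepFamily_of_forall_exists_avoiding`
run in `↥R` and read back in `G`): if every independent family of fewer than `s` elements of `R` of order `N` is avoided by an
element of `R` of order `N`, there is an independent family of `s` elements of `R` of order `N`.
[cite: McCallumLMS1991, Prop. 5.2] -/
theorem exists_indepFamily_mem_of_forall_exists_avoiding {N s : ℕ}
    (havoid : ∀ i < s, ∀ x : Fin i → G, (∀ k, x k ∈ R) → (∀ k, addOrderOf (x k) = N) →
      (∀ c : Fin i → ℤ, ∑ k, c k • x k = 0 → ∀ k, (N : ℤ) ∣ c k) →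
      ∃ y : G, y ∈ R ∧ addOrderOf y = N ∧ ∀ (m : ℤ) (c : Fin i → ℤ), m • y = ∑ k, c k • x k → (N : ℤ) ∣ m) :
    ∃ x : Fin s → G, (∀ k, x k ∈ R) ∧ (∀ k, addOrderOf (x k) = N) ∧
      ∀ c : Fin s → ℤ, ∑ k, c k • x k = 0 → ∀ k, (N : ℤ) ∣ c k := by
  have hinj : Function.Injective R.subtype := R.subtype_injective
  -- run the greedy lemma in `↥R`
  obtain ⟨x, hord, hind⟩ := exists_indepFamily_of_forall_exists_avoiding (A := R) (N := N) (s := s)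
    (fun i hi x hordx hindx ↦ by
      obtain ⟨y, hyR, hy, hav⟩ := havoid i hi (fun k ↦ (x k : G)) (fun k ↦ (x k).2)
        (fun k ↦ by rw [← hordx k]; exact (AddSubgroup.addOrderOf_coe (x k)))
        (fun c hc ↦ hindx c (hinj (by simpa using hc)))
      refine ⟨⟨y, hyR⟩, ?_, fun m c hmc ↦ hav m c ?_⟩
      · rw [← hy]; exact (AddSubgroup.addOrderOf_coe (⟨y, hyR⟩ : R)).symm
      · have h := congrArg R.subtype hmc
        simpa using h)
  refine ⟨fun k ↦ (x k : G), fun k ↦ (x k).2, fun k ↦ ?_, fun c hc ↦ hind c (hinj (by simpa using hc))⟩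
  rw [← hord k]
  exact AddSubgroup.addOrderOf_coe (x k)

end Greedy

/-! ## §2 The frame theorem from avoidance -/

section Frame

variable (W : WeierstrassCurve ℚ) [W.IsElliptic] [W.IsGloballyMinimal] (K : Type) [Field K] [NumberField K]
  {Wd : WeierstrassCurve ℚ} [Wd.IsElliptic]

/-- From the AVOIDANCE statement at one rung (in `H¹(ℚ, X)`, classes restricting into `Ш(X_K/K)`) to the independent family the
frame theorem wants. [cite: McCallumLMS1991, Prop. 5.2] -/
theorem exists_shaFamily_of_forall_exists_avoiding (X : WeierstrassCurve ℚ) {a s : ℕ}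
    (havoid : ∀ i < s, ∀ x : Fin i → X.galH1, (∀ k, resBaseChange X K (x k) ∈ (X.baseChange K).sha) →
      (∀ k, addOrderOf (x k) = 2 ^ a) → (∀ c : Fin i → ℤ, ∑ k, c k • x k = 0 → ∀ k, ((2 ^ a : ℕ) : ℤ) ∣ c k) →
      ∃ y : X.galH1, resBaseChange X K y ∈ (X.baseChange K).sha ∧ addOrderOf y = 2 ^ a ∧
        ∀ (m : ℤ) (c : Fin i → ℤ), m • y = ∑ k, c k • x k → ((2 ^ a : ℕ) : ℤ) ∣ m) :
    ∃ x : Fin s → X.galH1, (∀ k, resBaseChange X K (x k) ∈ (X.baseChange K).sha) ∧ (∀ k, addOrderOf (x k) = 2 ^ a) ∧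
      ∀ c : Fin s → ℤ, ∑ k, c k • x k = 0 → ∀ k, ((2 ^ a : ℕ) : ℤ) ∣ c k := by
  set R : AddSubgroup X.galH1 := ((X.baseChange K).sha).comap (resBaseChange X K) with hR
  obtain ⟨x, hmem, hord, hind⟩ := exists_indepFamily_mem_of_forall_exists_avoiding R (N := 2 ^ a) (s := s)
    (fun i hi x hx hordx hindx ↦ by
      obtain ⟨y, hy, hyo, hav⟩ := havoid i hi x (fun k ↦ AddSubgroup.mem_comap.mp (hx k)) hordx hindx
      exact ⟨y, AddSubgroup.mem_comap.mpr hy, hyo, hav⟩)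
  exact ⟨x, fun k ↦ AddSubgroup.mem_comap.mp (hmem k), hord, hind⟩

/-- **THE FRAME THEOREM FROM AVOIDANCE (McCallum Prop. 5.2's shape).**  On the LINE 18 frame, suppose that for every `m < T`:
(odd depth `2m+1`, over `W`) every independent family of fewer than `2m+2` classes of `H¹(ℚ, W)` of order `2^{M_{2m}−M_{2m+1}}`
restricting into `Ш(W_K/K)` is avoided by such a class; (even depth `2m+2`, over `Wd`) likewise with order `2^{M_{2m+1}−M_{2m+2}}`
and `Ш(Wd_K/K)`.  Then `2·M₀ ≤ ord₂ g + ord₂ g′ + 4⌊ord₂ C(Wd)/2⌋`. [cite: McCallumLMS1991, §5 Prop. 5.2, Thm. 5.4]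
[cite: Kramer1981, §2 Prop. 3 and Thm. 1] -/
theorem two_mul_le_padicValNat_add_of_shaAvoiding (hΔ : W.Δ < 0) (hT : Odd W.tamagawaProduct)
    (hIQ : IsImaginaryQuadratic K) (hodd : Odd (NumberField.discr K)) (hHe : SatisfiesHeegnerHypothesis (W.conductorNorm ℤ) K)
    (Cd : VariableChange ℚ) (hWd : Cd • W.quadraticTwist (NumberField.discr K : ℚ) = Wd)
    (hg : 0 < Nat.card (AddCommGroup.primaryComponent W.sha 2)) (hg' : 0 < Nat.card (AddCommGroup.primaryComponent Wd.sha 2))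
    (T : ℕ) (M : ℕ → ℕ) (hM : ∀ j, M (j + 1) ≤ M j) (hMT : M (2 * T) = 0)
    (hav : ∀ m < T, ∀ i < 2 * m + 2, ∀ x : Fin i → W.galH1, (∀ k, resBaseChange W K (x k) ∈ (W.baseChange K).sha) →
      (∀ k, addOrderOf (x k) = 2 ^ (M (2 * m) - M (2 * m + 1))) →
      (∀ c : Fin i → ℤ, ∑ k, c k • x k = 0 → ∀ k, ((2 ^ (M (2 * m) - M (2 * m + 1)) : ℕ) : ℤ) ∣ c k) →
      ∃ y : W.galH1, resBaseChange W K y ∈ (W.baseChange K).sha ∧ addOrderOf y = 2 ^ (M (2 * m) - M (2 * m + 1)) ∧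
        ∀ (n : ℤ) (c : Fin i → ℤ), n • y = ∑ k, c k • x k → ((2 ^ (M (2 * m) - M (2 * m + 1)) : ℕ) : ℤ) ∣ n)
    (hav' : ∀ m < T, ∀ i < 2 * m + 2, ∀ x : Fin i → Wd.galH1, (∀ k, resBaseChange Wd K (x k) ∈ (Wd.baseChange K).sha) →
      (∀ k, addOrderOf (x k) = 2 ^ (M (2 * m + 1) - M (2 * m + 2))) →
      (∀ c : Fin i → ℤ, ∑ k, c k • x k = 0 → ∀ k, ((2 ^ (M (2 * m + 1) - M (2 * m + 2)) : ℕ) : ℤ) ∣ c k) →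
      ∃ y : Wd.galH1, resBaseChange Wd K y ∈ (Wd.baseChange K).sha ∧ addOrderOf y = 2 ^ (M (2 * m + 1) - M (2 * m + 2)) ∧
        ∀ (n : ℤ) (c : Fin i → ℤ), n • y = ∑ k, c k • x k → ((2 ^ (M (2 * m + 1) - M (2 * m + 2)) : ℕ) : ℤ) ∣ n) :
    2 * M 0 ≤ padicValNat 2 (Nat.card (AddCommGroup.primaryComponent W.sha 2)) +
      padicValNat 2 (Nat.card (AddCommGroup.primaryComponent Wd.sha 2)) +
      2 * (padicValNat 2 Wd.tamagawaProduct / 2) + 2 * (padicValNat 2 Wd.tamagawaProduct / 2) :=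
  two_mul_le_padicValNat_add_of_shaLadders W K hΔ hT hIQ hodd hHe Cd hWd hg hg' T M hM hMT
    (fun m hm ↦ exists_shaFamily_of_forall_exists_avoiding K W (hav m hm))
    (fun m hm ↦ exists_shaFamily_of_forall_exists_avoiding K Wd (hav' m hm))

/-- **3a‴ ON `ord₂ C(Wd) = 1` FROM AVOIDANCE**: with `ord₂ C(Wd) = 1`, the avoidance statements at every rung give
`2·M₀ ≤ ord₂ g + ord₂ g′ + ord₂ C(Wd) − 1`, the conclusion of `stub_twinLadderGenus` verbatim.
[cite: McCallumLMS1991, §5 Prop. 5.2, Thm. 5.4, Cor. 5.6] -/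
theorem twinLadderGenus_ineq_of_shaAvoiding_of_padicValNat_eq_one (hΔ : W.Δ < 0) (hT : Odd W.tamagawaProduct)
    (hIQ : IsImaginaryQuadratic K) (hodd : Odd (NumberField.discr K)) (hHe : SatisfiesHeegnerHypothesis (W.conductorNorm ℤ) K)
    (Cd : VariableChange ℚ) (hWd : Cd • W.quadraticTwist (NumberField.discr K : ℚ) = Wd)
    (hB : padicValNat 2 Wd.tamagawaProduct = 1)
    (hg : 0 < Nat.card (AddCommGroup.primaryComponent W.sha 2)) (hg' : 0 < Nat.card (AddCommGroup.primaryComponent Wd.sha 2))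
    (T : ℕ) (M : ℕ → ℕ) (hM : ∀ j, M (j + 1) ≤ M j) (hMT : M (2 * T) = 0)
    (hav : ∀ m < T, ∀ i < 2 * m + 2, ∀ x : Fin i → W.galH1, (∀ k, resBaseChange W K (x k) ∈ (W.baseChange K).sha) →
      (∀ k, addOrderOf (x k) = 2 ^ (M (2 * m) - M (2 * m + 1))) →
      (∀ c : Fin i → ℤ, ∑ k, c k • x k = 0 → ∀ k, ((2 ^ (M (2 * m) - M (2 * m + 1)) : ℕ) : ℤ) ∣ c k) →
      ∃ y : W.galH1, resBaseChange W K y ∈ (W.baseChange K).sha ∧ addOrderOf y = 2 ^ (M (2 * m) - M (2 * m + 1)) ∧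
        ∀ (n : ℤ) (c : Fin i → ℤ), n • y = ∑ k, c k • x k → ((2 ^ (M (2 * m) - M (2 * m + 1)) : ℕ) : ℤ) ∣ n)
    (hav' : ∀ m < T, ∀ i < 2 * m + 2, ∀ x : Fin i → Wd.galH1, (∀ k, resBaseChange Wd K (x k) ∈ (Wd.baseChange K).sha) →
      (∀ k, addOrderOf (x k) = 2 ^ (M (2 * m + 1) - M (2 * m + 2))) →
      (∀ c : Fin i → ℤ, ∑ k, c k • x k = 0 → ∀ k, ((2 ^ (M (2 * m + 1) - M (2 * m + 2)) : ℕ) : ℤ) ∣ c k) →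
      ∃ y : Wd.galH1, resBaseChange Wd K y ∈ (Wd.baseChange K).sha ∧ addOrderOf y = 2 ^ (M (2 * m + 1) - M (2 * m + 2)) ∧
        ∀ (n : ℤ) (c : Fin i → ℤ), n • y = ∑ k, c k • x k → ((2 ^ (M (2 * m + 1) - M (2 * m + 2)) : ℕ) : ℤ) ∣ n) :
    (2 * M 0 : ℤ) ≤ (padicValNat 2 (Nat.card (AddCommGroup.primaryComponent W.sha 2)) : ℤ) +
      (padicValNat 2 (Nat.card (AddCommGroup.primaryComponent Wd.sha 2)) : ℤ) +
      (padicValNat 2 Wd.tamagawaProduct : ℤ) - 1 :=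
  twinLadderGenus_ineq_of_shaLadders_of_padicValNat_eq_one W K hΔ hT hIQ hodd hHe Cd hWd hB hg hg' T M hM hMT
    (fun m hm ↦ exists_shaFamily_of_forall_exists_avoiding K W (hav m hm))
    (fun m hm ↦ exists_shaFamily_of_forall_exists_avoiding K Wd (hav' m hm))

end Frame

end Summit.BirchSwinnertonDyer.BirchSwinnertonDyer.Theorems.GenusExact.PlusDescent

end
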